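import Mathlib
import Literature.NumberTheory.Transcendental.KZCalculusProofs

/-!
# Stub `stub_rungInclusion` — crux `OffTetraSectorKernel`, line `odd-hyperbolic-ladder`

Pure algebra closing one rung of Goncharov's hyperbolic scissors ladder inside Kontsevich–Zagier's
calculus of moves. Rung `n` is the upper half-space `ℝⁿ × ℝ₊` of `ℍⁿ⁺¹` with coordinates
`p : Fin (n + 1) → ℝ`, height `t = p (Fin.last n)` and density `t^{-(n+1)}`.

Given a class `D` of domains and
* (hT) *transfer*: for every admissible family `ρ` on `D` the additive map
  `FreeAbelianGroup.lift (fun P => KZ.of (ρ P))` sends the closure of the scissors relators over `D`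
  into `KZ.relations`;
* (hV) *volume injectivity* (rational form): every `ℤ`-relation `Σ mᵢ · ∫_{Pᵢ} t^{-(n+1)} = 0`
  among volumes of members of `D` becomes, after multiplication by some `M > 0`, an element of the
  closure of the scissors relators;
* (hF) *torsion-freeness* of `FormalRep / relations`,

every value-relator `Σ mᵢ • KZ.of (ρ (P i))` with `Σ mᵢ · value = 0` lies in `KZ.relations`:
values are volumes (`setIntegral_congr_fun`), apply (hV), push through the lift
(`map_nsmul`, `map_sum`, `map_zsmul`, `FreeAbelianGroup.lift_apply_of`) and kill `M` with (hF).
-/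

noncomputable section

open Set MeasureTheory

namespace Summit.KontsevichZagierPeriods.HyperbolicBloch.OffTetraSectorKernel

/-- **Rung inclusion.** Transfer of the scissors relators, volume injectivity on the class `D`
and torsion-freeness of `FormalRep / relations` put every value-relator
`Σ mᵢ • [ρ Pᵢ]` (`Σ mᵢ · vol Pᵢ = 0`, `Pᵢ ∈ D`) of the rung in `KZ.relations`.
[cite: Goncharov1999, §1.7] -/
theorem stub_rungInclusion : ∀ (n : ℕ) (D : Set (Set (Fin (n + 1) → ℝ))), (∀ (ρ : Set (Fin (n + 1) → ℝ) → Literature.NumberTheory.Transcendental.KZ.IntegralRep (n + 1)), (∀ P ∈ D, (ρ P).domain = P ∧ Set.EqOn (ρ P).integrand (fun p : Fin (n + 1) → ℝ => 1 / p (Fin.last n) ^ (n + 1)) P) → ∀ x ∈ AddSubgroup.closure ({x : FreeAbelianGroup (Set (Fin (n + 1) → ℝ)) | ∃ P P₁ P₂ : Set (Fin (n + 1) → ℝ), P ∈ D ∧ P₁ ∈ D ∧ P₂ ∈ D ∧ P₁ ⊆ P ∧ P₂ ⊆ P ∧ MeasureTheory.volume (P₁ ∩ P₂) = 0 ∧ MeasureTheory.volume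 (P \ (P₁ ∪ P₂)) = 0 ∧ x = FreeAbelianGroup.of P - FreeAbelianGroup.of P₁ - FreeAbelianGroup.of P₂} ∪ {x : FreeAbelianGroup (Set (Fin (n + 1) → ℝ)) | ∃ P P' : Set (Fin (n + 1) → ℝ), P ∈ D ∧ P' ∈ D ∧ P' = (fun p : Fin (n + 1) → ℝ => fun l => p l / ∑ m, p m ^ 2) '' P ∧ x = FreeAbelianGroup.of P' - FreeAbelianGroup.of P} ∪ {x : FreeAbelianGroup (Set (Fin (n + 1) → ℝ)) | ∃ (P P' : Set (Fin (n + 1) → ℝ)) (c : ℝ) (A : Matrix (Fin n) (Fin n) ℝ) (b : Fin n → ℝ), P ∈ D ∧ P' ∈ D ∧ IsAlgebraic ℚ c ∧ 0 < c ∧ (∀ i j, IsAlgebraic ℚ (A i j)) ∧ A.transpose * A = 1 ∧ (∀ i, IsAlgebraic ℚ (b i)) ∧ P' = (fun p : Fin (n + 1) → ℝ => (Fin.snoc (α := fun _ => ℝ) (c • A.mulVec (Fin.init p) + b) (c * p (Fin.last n)) : Fin (n + 1) → ℝ)) '' P ∧ x = FreeAbelianGroup.of P' - FreeAbelianGroup.of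 P}), FreeAbelianGroup.lift (fun P : Set (Fin (n + 1) → ℝ) => Literature.NumberTheory.Transcendental.KZ.of (ρ P)) x ∈ Literature.NumberTheory.Transcendental.KZ.relations) → (∀ (k : ℕ) (P : Fin k → Set (Fin (n + 1) → ℝ)) (m : Fin k → ℤ), (∀ i, P i ∈ D) → ∑ i, (m i : ℝ) * (∫ p in P i, 1 / p (Fin.last n) ^ (n + 1)) = 0 → ∃ M : ℕ, 0 < M ∧ M • ∑ i, m i • FreeAbelianGroup.of (P i) ∈ AddSubgroup.closure ({x : FreeAbelianGroup (Set (Fin (n + 1) → ℝ)) | ∃ P P₁ P₂ : Set (Fin (n + 1) → ℝ), P ∈ D ∧ P₁ ∈ D ∧ P₂ ∈ D ∧ P₁ ⊆ P ∧ P₂ ⊆ P ∧ MeasureTheory.volume (P₁ ∩ P₂) = 0 ∧ MeasureTheory.volume (P \ (P₁ ∪ P₂)) = 0 ∧ x = FreeAbelianGroup.of P - FreeAbelianGroup.of P₁ - FreeAbelianGroup.of P₂} ∪ {x : FreeAbelianGroup (Set (Fin (n + 1) → ℝ)) | ∃ P P' : Set (Fin (n + 1) → ℝ), P ∈ D ∧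 P' ∈ D ∧ P' = (fun p : Fin (n + 1) → ℝ => fun l => p l / ∑ m, p m ^ 2) '' P ∧ x = FreeAbelianGroup.of P' - FreeAbelianGroup.of P} ∪ {x : FreeAbelianGroup (Set (Fin (n + 1) → ℝ)) | ∃ (P P' : Set (Fin (n + 1) → ℝ)) (c : ℝ) (A : Matrix (Fin n) (Fin n) ℝ) (b : Fin n → ℝ), P ∈ D ∧ P' ∈ D ∧ IsAlgebraic ℚ c ∧ 0 < c ∧ (∀ i j, IsAlgebraic ℚ (A i j)) ∧ A.transpose * A = 1 ∧ (∀ i, IsAlgebraic ℚ (b i)) ∧ P' = (fun p : Fin (n + 1) → ℝ => (Fin.snoc (α := fun _ => ℝ) (c • A.mulVec (Fin.init p) + b) (c * p (Fin.last n)) : Fin (n + 1) → ℝ)) '' P ∧ x = FreeAbelianGroup.of P' - FreeAbelianGroup.of P})) → (∀ (k : ℕ) (c : Literature.NumberTheory.Transcendental.KZ.FormalRep), k ≠ 0 → k • c ∈ Literature.NumberTheory.Transcendental.KZ.relations → c ∈ Literature.NumberTheory.Transcendental.KZ.relations) → ∀ (ρ : Set (Fin (n + 1) → ℝ) → Literature.NumberTheory.Transcendental.KZ.IntegralRep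 (n + 1)), (∀ P ∈ D, (ρ P).domain = P ∧ Set.EqOn (ρ P).integrand (fun p : Fin (n + 1) → ℝ => 1 / p (Fin.last n) ^ (n + 1)) P) → ∀ (k : ℕ) (P : Fin k → Set (Fin (n + 1) → ℝ)) (m : Fin k → ℤ), (∀ i, P i ∈ D) → ∑ i, (m i : ℝ) * (ρ (P i)).value = 0 → ∑ i, m i • Literature.NumberTheory.Transcendental.KZ.of (ρ (P i)) ∈ Literature.NumberTheory.Transcendental.KZ.relations := by
  intro n D hT hV hF ρ hρ k P m hP hsum
  -- (1) values are volumes: `(ρ (P i)).value = ∫_{P i} t^{-(n+1)}`.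
  have hval : ∀ i, (ρ (P i)).value = ∫ p in P i, 1 / p (Fin.last n) ^ (n + 1) := by
    intro i
    obtain ⟨hdom, heq⟩ := hρ (P i) (hP i)
    have hmeas : MeasurableSet (ρ (P i)).domain :=
      Literature.NumberTheory.Transcendental.KZ.IntegralRep.measurableSet_domain_holds (ρ (P i))
    rw [hdom] at hmeas
    simp only [Literature.NumberTheory.Transcendental.KZ.IntegralRep.value]
    rw [hdom]
    exact setIntegral_congr_fun hmeas heq
  have hvol : ∑ i, (m i : ℝ) * (∫ p in P i, 1 / p (Fin.last n) ^ (n + 1)) = 0 := by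
    simpa only [hval] using hsum
  -- (2) volume injectivity: a positive multiple of `Σ mᵢ • [P i]` is a scissors relation.
  obtain ⟨M, hM, hmem⟩ := hV k P m hP hvol
  -- (3) transfer through the lift `[P] ↦ [ρ P]`.
  have h := hT ρ hρ _ hmem
  simp only [map_nsmul, map_sum, map_zsmul, FreeAbelianGroup.lift_apply_of] at h
  -- (4) torsion-freeness kills `M`.
  exact hF M _ hM.ne' h

end Summit.KontsevichZagierPeriods.HyperbolicBloch.OffTetraSectorKernel

end
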